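import Summits.CriticalPhenomena.Ising3D.TaylorTableOddCoeffTM2
import HarnessLib

/-!
# The TABLE layer XXIVa′: RELATIVE position chunks of the τ-triple table (`stack2`) and their glue to `rows2`
(cell `pub-ising3x`, seat boot-1 gen 16; emitter requirement (E5) of LEAN-PLAN-MERGED2: a merged-2 cell's triple table is certified in
byte-capped chunks, each computing only its own levels from the previous chunk's last row)

HONEST FRAMING: lottery ticket; floor = tightest certified 3D Ising CFT bounds; no exact-solution
claim without a proof. Island framing: certified exclusion region at stated derivative order and
assumptions; not a determination of the 3D Ising critical exponents beyond that.

`HRTMAB2.rows2 … (n+1) = stepRow2 … n (head (rows2 … n)) :: rows2 … n`: level `n+1` depends only on the row of level `n`. A table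
file for positions `[k₀, k₁)` of the full table (levels `nF−k₁+1 … nF−k₀`) therefore states
`stack2 … (nF−k₁) prev (k₁−k₀) = T_chunk ++ [prev]` with `prev` = the literal row of level `nF−k₁` (the first row of the next chunk), decided
by the kernel in time proportional to the chunk alone; `rows2_add_eq_stack2` / `rows2_add_of_chunk` glue the chunks back to `rows2 … nF`. [folklore]
-/

namespace Summit.CriticalPhenomena.Ising3D

namespace HRTMAB2

/-- `k` more levels of the triple recursion stacked on the row `prev` of level `n0`: `[row_{n0+k}, …, row_{n0+1}, prev]`. [folklore] -/
def stack2 (S : ℕ) (A : ℚ) (ℓ e D : ℕ) (Wn : ℤ) (Wd : ℕ) (a0 a1 b0 b1 : ℚ) (n0 : ℕ) (prev : List TPoly) : ℕ → List (List TPoly)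
  | 0 => [prev]
  | k + 1 =>
      let st := stack2 S A ℓ e D Wn Wd a0 a1 b0 b1 n0 prev k
      stepRow2 S A ℓ e D Wn Wd a0 a1 b0 b1 (n0 + k) (st.headD []) :: st

/-- The stack has `k + 1` rows. [folklore] -/
theorem length_stack2 (S : ℕ) (A : ℚ) (ℓ e D : ℕ) (Wn : ℤ) (Wd : ℕ) (a0 a1 b0 b1 : ℚ) (n0 : ℕ) (prev : List TPoly) :
    ∀ k : ℕ, (stack2 S A ℓ e D Wn Wd a0 a1 b0 b1 n0 prev k).length = k + 1
  | 0 => rfl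
  | k + 1 => by simp only [stack2, List.length_cons, length_stack2]

/-- **Glue**: the table of `n0 + k` levels is the stack on the true level-`n0` row, minus its base row, on top of the table of `n0` levels. [folklore] -/
theorem rows2_add_eq_stack2 (S : ℕ) (A : ℚ) (ℓ e D : ℕ) (Wn : ℤ) (Wd : ℕ) (a0 a1 b0 b1 : ℚ) (n0 : ℕ) :
    ∀ k : ℕ, rows2 S A ℓ e D Wn Wd a0 a1 b0 b1 (n0 + k) =
      (stack2 S A ℓ e D Wn Wd a0 a1 b0 b1 n0 ((rows2 S A ℓ e D Wn Wd a0 a1 b0 b1 n0).headD []) k).dropLast ++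
        rows2 S A ℓ e D Wn Wd a0 a1 b0 b1 n0
  | 0 => by simp [stack2]
  | k + 1 => by
      have ih := rows2_add_eq_stack2 S A ℓ e D Wn Wd a0 a1 b0 b1 n0 k
      -- the head of rows2 (n0+k) is the head of the stack
      have hhead : (rows2 S A ℓ e D Wn Wd a0 a1 b0 b1 (n0 + k)).headD [] =
          (stack2 S A ℓ e D Wn Wd a0 a1 b0 b1 n0 ((rows2 S A ℓ e D Wn Wd a0 a1 b0 b1 n0).headD []) k).headD [] := by
        cases k with
        | zero => simp [stack2]
        | succ k =>
            rw [ih]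
            simp only [stack2, List.dropLast_cons_of_ne_nil (List.ne_nil_of_length_eq_add_one (length_stack2 _ _ _ _ _ _ _ _ _ _ _ _ _ k)),
              List.cons_append, List.headD_cons]
      rw [Nat.add_succ, rows2_succ, hhead, ih]
      simp only [stack2]
      rw [List.dropLast_cons_of_ne_nil (List.ne_nil_of_length_eq_add_one (length_stack2 _ _ _ _ _ _ _ _ _ _ _ _ _ k)),
        List.cons_append]

/-- **Chunk gluing, the form the table files use**: if the kernel decided `stack2 … n0 prev k = T ++ [prev]` for the literal `prev` that IS the
top row of `rows2 … n0`, then `rows2 … (n0 + k) = T ++ rows2 … n0`. [folklore] -/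
theorem rows2_add_of_chunk {S : ℕ} {A : ℚ} {ℓ e D : ℕ} {Wn : ℤ} {Wd : ℕ} {a0 a1 b0 b1 : ℚ} {n0 k : ℕ} {prev : List TPoly} {T : List (List TPoly)}
    (hprev : (rows2 S A ℓ e D Wn Wd a0 a1 b0 b1 n0).headD [] = prev)
    (hk : stack2 S A ℓ e D Wn Wd a0 a1 b0 b1 n0 prev k = T ++ [prev]) :
    rows2 S A ℓ e D Wn Wd a0 a1 b0 b1 (n0 + k) = T ++ rows2 S A ℓ e D Wn Wd a0 a1 b0 b1 n0 := by
  rw [rows2_add_eq_stack2, hprev, hk, List.dropLast_concat]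

end HRTMAB2

end Summit.CriticalPhenomena.Ising3D
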